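import Literature.NumberTheory.Automorphic.UnitaryGroupUnipotentRationalBorel
import HarnessLib

/-!
# The rational Borel subgroup containing a non-central element of the class `(X − z)³` of `U(J₃)(F)` is unique
(Rogawski, *Automorphic Representations of Unitary Groups in Three Variables* (1990), proof of Prop. 7.2.1,
pp. 91–92: «`h` lies in `B`. For if `h ∉ B`, then `h = bwb′` … and `h⁻¹Nh ∩ N = w⁻¹Nw ∩ N = {1}`. Hence `δ` is
unique modulo `B_γ`»; §3.9 p. 32: regular `u(x, z)`, `x ≠ 0`, and singular `n(t)` unipotent classes.)

Topic `NumberTheory/Automorphic`; namespace `Literature.NumberTheory.Automorphic.UnitaryGroup`. THEOREMS ONLY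
over accepted tree modules (no definition, no named fact, no instance, no notation, no `sorry`). Sequel of ★
`UnitaryGroupUnipotentRationalBorel` (existence: every `γ ∈ G(F)` with `charpoly γ = (X − z)³`, `z ∈ E¹`, is
`G(F)`-conjugate INTO `B(F)`); here the UNIQUENESS half of the algebraic part of [Rogawski1990, Prop. 7.2.1] at
the central class `z · 𝒰(F)` — item (L5-i) «the unipotent term `P_{z·𝒰}`» of the T1-qs LAW 5 road of
`Cruxes/H413/Lines/F0_T1InnerFormTraceIdentity.lean` (cell `pub/hodgecm-mathlib`, crux H413). Bruhat-free: a
non-central element of `z · N(F)` fixes EXACTLY ONE isotropic line, so its normalising cosets are one `B(F)`-coset.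

* `apply_self_eq_of_blockTriangular_of_charpoly_eq` — an upper triangular matrix with `charpoly = (X − z)³` has
  diagonal `(z,z,z)`.
* **`eq_smul_single_of_vecMul_eq_smul`** — for `β ∈ B(F)` with `charpoly β = (X − z)³` (`z ∈ E¹`) and `β ≠ z·1`,
  every isotropic row `ξ` with `ξ ᵥ* β = z • ξ` is a multiple of `e₃` (entrywise: `β₁₂ = −z² c(β₀₁)` by the
  `(1,2)` unitarity relation ★ `mem_unitaryGroupOfForm_antidiagonal_iff_sum'`; `β₀₁ ≠ 0 ⇒ ξ₀ = ξ₁ = 0`;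
  `β₀₁ = 0 ⇒ β₁₂ = 0`, so `β ≠ z·1 ⇒ β₀₂ ≠ 0 ⇒ ξ₀ = 0`, and isotropy `ξ₁ c(ξ₁) = 0`).
* **`mem_arithmeticBorel_of_conj_mem_of_conj_mem`** — if `δ₁ γ δ₁⁻¹ ∈ B(F)` and `δ₂ γ δ₂⁻¹ ∈ B(F)` for a
  non-central `γ` of the class `(X − z)³` then `δ₂ δ₁⁻¹ ∈ B(F)`: with the existence theorem, the map
  `(B(F)δ, n) ↦ δ⁻¹ n δ` (`n ∈ z·N(F) ∖ {z·1}`) is a BIJECTION onto `𝔬 ∖ {z·1}` — the regrouping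
  `Σ_{γ ∈ 𝔬} = f(z) + Σ_{δ ∈ B(F)\G(F)} Σ_{u ∈ N(F), u ≠ 1}` of [Rogawski1990, §7.3 p. 95] for `k^T_𝔬`.

## References

* J. D. Rogawski, *Automorphic Representations of Unitary Groups in Three Variables*, Annals of
  Mathematics Studies 123 (1990), Prop. 7.2.1 (pp. 91–92), §3.9 (p. 32), §7.3 (p. 95) [Rogawski1990].
* J. Arthur, *A trace formula for reductive groups I*, Duke Math. J. 45 (1978), §8 [Arthur1978TraceFormulaI].
-/

set_option autoImplicit false

noncomputable section

open NumberField IsDedekindDomain Matrix Polynomial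
open scoped MatrixGroups

namespace Literature.NumberTheory.Automorphic

namespace UnitaryGroup

variable {F E : Type} [Field F] [NumberField F] [Field E] [NumberField E] [Algebra F E]
  {c : E ≃ₐ[F] E}

omit [NumberField F] [NumberField E] in
/-- `rev` on `Fin 3`. [cite: Rogawski1990, §1.10] -/
private theorem rev_fin_three' :
    (0 : Fin 3).rev = 2 ∧ (1 : Fin 3).rev = 1 ∧ (2 : Fin 3).rev = 0 := ⟨rfl, rfl, rfl⟩

omit [NumberField F] [NumberField E] in
/-- Rows of a product: `(row_a A) ᵥ* B = row_a (A B)`. [folklore] [cite: Rogawski1990, §1.10] -/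
private theorem row_vecMul {N : ℕ} (A B : Matrix (Fin N) (Fin N) E) (a : Fin N) :
    (fun j => A a j) ᵥ* B = fun j => (A * B) a j := by
  funext j
  simp only [Matrix.vecMul, dotProduct, Matrix.mul_apply]

/-- Last row of a product of rational points: `e₃ (p q) = (e₃ p) ᵥ* q`. [cite: Rogawski1990, §1.10] -/
private theorem ratLastRow_mul (p q : (quasiSplit F E c 3).Rational) :
    (fun j : Fin 3 => (((p * q).1 : GL (Fin 3) E) : Matrix (Fin 3) (Fin 3) E) ⊤ j) =
      (fun j : Fin 3 => ((p.1 : GL (Fin 3) E) : Matrix (Fin 3) (Fin 3) E) ⊤ j) ᵥ*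
        ((q.1 : GL (Fin 3) E) : Matrix (Fin 3) (Fin 3) E) := by
  rw [row_vecMul]
  rfl

/-! ## §3 Uniqueness: a non-central element of `B(F)` of the class `(X − z)³` fixes only the line `F e₃` -/

omit [NumberField F] [NumberField E] in
/-- An upper triangular matrix with `charpoly = (X − z)³` has diagonal `(z, z, z)`
(Mathlib `Matrix.charpoly_of_upperTriangular`). [cite: Rogawski1990, §1.9 (p. 9)] -/
theorem apply_self_eq_of_blockTriangular_of_charpoly_eq {B : Matrix (Fin 3) (Fin 3) E}
    (hB : B.BlockTriangular id) {z : E} (hchar : B.charpoly = (X - C z) ^ 3) (i : Fin 3) : B i i = z := by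
  have h := Matrix.charpoly_of_upperTriangular B hB
  rw [hchar] at h
  have h0 : ((X - C z) ^ 3 : E[X]).eval (B i i) = 0 := by
    rw [h, Polynomial.eval_prod]
    exact Finset.prod_eq_zero (Finset.mem_univ i) (by simp)
  simp only [eval_pow, eval_sub, eval_X, eval_C] at h0
  exact sub_eq_zero.1 (pow_eq_zero_iff (by norm_num) |>.1 h0)

/-- **A NON-CENTRAL `β ∈ B(F)` OF THE CLASS `(X − z)³` (`z ∈ E¹`) FIXES ONLY THE LINE `F e₃`**: if `ξ` is an
isotropic row with `ξ ᵥ* β = z • ξ` then `ξ = ξ₃ e₃`. Entrywise, `β = z·u(x, w)` with `β₁₂ = −z² c(β₀₁)` (the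
`(1,2)` unitarity relation of ★ `mem_unitaryGroupOfForm_antidiagonal_iff_sum'`); the eigen-equations read
`ξ₀ β₀₁ = 0`, `ξ₀ β₀₂ + ξ₁ β₁₂ = 0`; if `β₀₁ ≠ 0` they give `ξ₀ = ξ₁ = 0`, and if `β₀₁ = 0` then `β₁₂ = 0`, so
`β ≠ z·1` forces `β₀₂ ≠ 0`, `ξ₀ = 0`, and isotropy `ξ₁ c(ξ₁) = 0` gives `ξ₁ = 0` — the REGULAR (`x ≠ 0`) and
SINGULAR (`x = 0`, `w ≠ 0`) unipotent classes of Rogawski (1990), §3.9. [cite: Rogawski1990, §3.9 (p. 32)] -/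
theorem eq_smul_single_of_vecMul_eq_smul (γ : (quasiSplit F E c 3).Rational)
    (hB : ((γ.1 : GL (Fin 3) E) : Matrix (Fin 3) (Fin 3) E).BlockTriangular id) {z : E} (hz : c z * z = 1)
    (hchar : ((γ.1 : GL (Fin 3) E) : Matrix (Fin 3) (Fin 3) E).charpoly = (X - C z) ^ 3)
    (hne : ((γ.1 : GL (Fin 3) E) : Matrix (Fin 3) (Fin 3) E) ≠ z • (1 : Matrix (Fin 3) (Fin 3) E)) {ξ : Fin 3 → E}
    (hiso : ∑ i, ξ i * c (ξ (Fin.rev i)) = 0)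
    (heig : ξ ᵥ* ((γ.1 : GL (Fin 3) E) : Matrix (Fin 3) (Fin 3) E) = z • ξ) :
    ξ = ξ ⊤ • Pi.single (⊤ : Fin 3) (1 : E) := by
  obtain ⟨r0, r1, r2⟩ := rev_fin_three' 
  set B : Matrix (Fin 3) (Fin 3) E := ((γ.1 : GL (Fin 3) E) : Matrix (Fin 3) (Fin 3) E) with hBdef
  have hd : ∀ i, B i i = z := apply_self_eq_of_blockTriangular_of_charpoly_eq hB hchar
  have h10 : B 1 0 = 0 := hB (show ((0 : Fin 3) : Fin 3) < 1 by decide)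
  have h20 : B 2 0 = 0 := hB (show ((0 : Fin 3) : Fin 3) < 2 by decide)
  have h21 : B 2 1 = 0 := hB (show ((1 : Fin 3) : Fin 3) < 2 by decide)
  have hz0 : z ≠ 0 := fun h => by rw [h, mul_zero] at hz; exact zero_ne_one hz
  have hcz0 : c z ≠ 0 := fun h => by rw [h, zero_mul] at hz; exact zero_ne_one hz
  -- the `(1,2)` unitarity relation: `c(B₀₁) z + c(z) B₁₂ = 0`
  have hrel : c (B 0 1) * z + c z * B 1 2 = 0 := by
    have h := (mem_unitaryGroupOfForm_antidiagonal_iff_sum' (c : E →+* E) 3 (γ.1 : GL (Fin 3) E)).1 γ.2 1 2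
    rw [Fin.sum_univ_three, r0, r1, r2, if_neg (by decide), ← hBdef] at h
    simpa [RingHom.coe_coe, hd, h21] using h
  -- the eigen-equations
  have he1 : ξ 0 * B 0 1 = 0 := by
    have h := congrFun heig 1
    simp only [Matrix.vecMul, dotProduct, Fin.sum_univ_three, Pi.smul_apply, smul_eq_mul, hd, h21,
      mul_zero, add_zero] at h
    -- `h : ξ 0 * B 0 1 + ξ 1 * z = z * ξ 1`
    linear_combination h
  have he2 : ξ 0 * B 0 2 + ξ 1 * B 1 2 = 0 := by
    have h := congrFun heig 2
    simp only [Matrix.vecMul, dotProduct, Fin.sum_univ_three, Pi.smul_apply, smul_eq_mul, hd] at h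
    -- `h : ξ 0 * B 0 2 + ξ 1 * B 1 2 + ξ 2 * z = z * ξ 2`
    linear_combination h
  have hiso' : ξ 0 * c (ξ 2) + ξ 1 * c (ξ 1) + ξ 2 * c (ξ 0) = 0 := by
    rw [Fin.sum_univ_three, r0, r1, r2] at hiso
    exact hiso
  -- `ξ₀ = ξ₁ = 0`
  have hξ01 : ξ 0 = 0 ∧ ξ 1 = 0 := by
    by_cases h01 : B 0 1 = 0
    · have h12 : B 1 2 = 0 := by
        rw [h01, map_zero, zero_mul, zero_add] at hrel
        exact (mul_eq_zero.1 hrel).resolve_left hcz0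
      have h02 : B 0 2 ≠ 0 := by
        intro h02
        apply hne
        ext i j
        fin_cases i <;> fin_cases j <;>
          simp [Matrix.smul_apply, hd, h01, h02, h10, h12, h20, h21]
      have hξ0 : ξ 0 = 0 := by
        rw [h12, mul_zero, add_zero] at he2
        exact (mul_eq_zero.1 he2).resolve_right h02
      refine ⟨hξ0, ?_⟩
      rw [hξ0, zero_mul, zero_add, map_zero, mul_zero, add_zero] at hiso'
      rcases mul_eq_zero.1 hiso' with h | h
      · exact h
      · exact (map_eq_zero_iff c c.injective).1 h
    · have hξ0 : ξ 0 = 0 := (mul_eq_zero.1 he1).resolve_right h01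
      have h12 : B 1 2 ≠ 0 := by
        intro h12
        apply h01
        rw [h12, mul_zero, add_zero] at hrel
        have := (mul_eq_zero.1 hrel).resolve_right hz0
        exact (map_eq_zero_iff c c.injective).1 this
      refine ⟨hξ0, ?_⟩
      rw [hξ0, zero_mul, zero_add] at he2
      exact (mul_eq_zero.1 he2).resolve_right h12
  have htop : (⊤ : Fin 3) = 2 := rfl
  funext j
  fin_cases j
  · simpa [Pi.single_apply, htop] using hξ01.1
  · simpa [Pi.single_apply, htop] using hξ01.2
  · simp [htop]


omit [NumberField F] [NumberField E] in
/-- `⟨e₃, e₃⟩ = 0`: the last basis row is isotropic for `J₃`. [cite: Rogawski1990, §1.10] -/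
private theorem sum_single_top_mul_conj_rev :
    ∑ i : Fin 3, (Pi.single (⊤ : Fin 3) (1 : E) : Fin 3 → E) i *
      c ((Pi.single (⊤ : Fin 3) (1 : E) : Fin 3 → E) (Fin.rev i)) = 0 := by
  obtain ⟨r0, r1, r2⟩ := rev_fin_three' 
  have htop : (⊤ : Fin 3) = 2 := rfl
  rw [Fin.sum_univ_three, r0, r1, r2, htop]
  simp

/-- Last row of a rational point as `e₃ ᵥ* γ` (Mathlib `Matrix.single_one_vecMul`). [cite: Rogawski1990, §1.10] -/
private theorem ratLastRow_eq_single_vecMul (p : (quasiSplit F E c 3).Rational) :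
    (fun j : Fin 3 => ((p.1 : GL (Fin 3) E) : Matrix (Fin 3) (Fin 3) E) ⊤ j) =
      Pi.single (⊤ : Fin 3) (1 : E) ᵥ* ((p.1 : GL (Fin 3) E) : Matrix (Fin 3) (Fin 3) E) := by
  rw [Matrix.single_one_vecMul]
  rfl

/-- **THE RATIONAL BOREL SUBGROUP CONTAINING A NON-CENTRAL ELEMENT OF THE CLASS `(X − z)³` IS UNIQUE**
(`z ∈ E¹`): if `δ₁ γ δ₁⁻¹ ∈ B(F)` and `δ₂ γ δ₂⁻¹ ∈ B(F)` then `δ₂ δ₁⁻¹ ∈ B(F)`, i.e. `B(F)δ₁ = B(F)δ₂`. With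
`β = δ₁ γ δ₁⁻¹ ∈ B(F)` and `h = δ₂ δ₁⁻¹`: `h β h⁻¹ ∈ B(F)` has last row `z e₃`, so the isotropic row `e₃ h`
satisfies `(e₃ h) β = z (e₃ h)`, hence is a multiple of `e₃` (`eq_smul_single_of_vecMul_eq_smul`), and `h`
stabilises `F e₃` (★ `mem_borelAdelic_toAdelic_of_lastRow_eq_smul`). This is the uniqueness «`δ` is unique modulo
`B_γ`» of Rogawski (1990), proof of Prop. 7.2.1 (there via `h⁻¹Nh ∩ N = {1}` for `h ∉ B`), at the central
class where `B_γ = B`. [cite: Rogawski1990, Prop. 7.2.1 (pp. 91–92)] -/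
theorem mem_arithmeticBorel_of_conj_mem_of_conj_mem {z : E} (hz : c z * z = 1)
    {γ δ₁ δ₂ : (quasiSplit F E c 3).arithmeticSubgroup}
    (hchar : ((adelicVal F E c 3 _ (γ : (quasiSplit F E c 3).Adelic) : GL (Fin 3) (AdeleRing (𝓞 E) E)) :
        Matrix (Fin 3) (Fin 3) (AdeleRing (𝓞 E) E)).charpoly =
      ((X - C z) ^ 3).map (algebraMap E (AdeleRing (𝓞 E) E)))
    (hne : ((adelicVal F E c 3 _ (γ : (quasiSplit F E c 3).Adelic) : GL (Fin 3) (AdeleRing (𝓞 E) E)) :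
        Matrix (Fin 3) (Fin 3) (AdeleRing (𝓞 E) E)) ≠
      algebraMap E (AdeleRing (𝓞 E) E) z • (1 : Matrix (Fin 3) (Fin 3) (AdeleRing (𝓞 E) E)))
    (h₁ : δ₁ * γ * δ₁⁻¹ ∈ arithmeticBorel F E c 3) (h₂ : δ₂ * γ * δ₂⁻¹ ∈ arithmeticBorel F E c 3) :
    δ₂ * δ₁⁻¹ ∈ arithmeticBorel F E c 3 := by
  obtain ⟨γ₀, hγ₀⟩ := γ.2
  obtain ⟨d₁, hd₁⟩ := δ₁.2
  obtain ⟨d₂, hd₂⟩ := δ₂.2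
  have hchar₀ := charpoly_eq_of_toAdelic_eq hγ₀ hchar
  -- rational avatars
  set β₀ : (quasiSplit F E c 3).Rational := d₁ * γ₀ * d₁⁻¹ with hβ₀
  set h₀ : (quasiSplit F E c 3).Rational := d₂ * d₁⁻¹ with hh₀
  have hβ₀A : (quasiSplit F E c 3).toAdelic β₀ = ((δ₁ * γ * δ₁⁻¹ : (quasiSplit F E c 3).arithmeticSubgroup) :
      (quasiSplit F E c 3).Adelic) := by
    rw [hβ₀, map_mul, map_mul, map_inv, hγ₀, hd₁]; rfl
  have hh₀A : (quasiSplit F E c 3).toAdelic h₀ = ((δ₂ * δ₁⁻¹ : (quasiSplit F E c 3).arithmeticSubgroup) :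
      (quasiSplit F E c 3).Adelic) := by
    rw [hh₀, map_mul, map_inv, hd₁, hd₂]; rfl
  have hκA : (quasiSplit F E c 3).toAdelic (h₀ * β₀ * h₀⁻¹) =
      ((δ₂ * γ * δ₂⁻¹ : (quasiSplit F E c 3).arithmeticSubgroup) : (quasiSplit F E c 3).Adelic) := by
    have : h₀ * β₀ * h₀⁻¹ = d₂ * γ₀ * d₂⁻¹ := by rw [hh₀, hβ₀]; group
    rw [this, map_mul, map_mul, map_inv, hγ₀, hd₂]; rfl
  -- `β₀` and `h₀ β₀ h₀⁻¹` are upper triangular with `charpoly = (X − z)³`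
  have hβB : ((β₀.1 : GL (Fin 3) E) : Matrix (Fin 3) (Fin 3) E).BlockTriangular id :=
    (toAdelic_mem_borelAdelic_iff β₀).1 (by rw [hβ₀A]; exact (mem_arithmeticBorel_iff _).1 h₁)
  have hκB : (((h₀ * β₀ * h₀⁻¹ : (quasiSplit F E c 3).Rational).1 : GL (Fin 3) E) :
      Matrix (Fin 3) (Fin 3) E).BlockTriangular id :=
    (toAdelic_mem_borelAdelic_iff _).1 (by rw [hκA]; exact (mem_arithmeticBorel_iff _).1 h₂)
  have hβchar : ((β₀.1 : GL (Fin 3) E) : Matrix (Fin 3) (Fin 3) E).charpoly = (X - C z) ^ 3 := by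
    rw [← hchar₀, hβ₀]
    change (((d₁.1 : GL (Fin 3) E) : Matrix (Fin 3) (Fin 3) E) * ((γ₀.1 : GL (Fin 3) E) : Matrix (Fin 3) (Fin 3) E) *
      (((d₁.1 : GL (Fin 3) E)⁻¹ : GL (Fin 3) E) : Matrix (Fin 3) (Fin 3) E)).charpoly = _
    rw [Matrix.coe_units_inv]
    exact Matrix.charpoly_units_conj _ _
  have hκchar : (((h₀ * β₀ * h₀⁻¹ : (quasiSplit F E c 3).Rational).1 : GL (Fin 3) E) :
      Matrix (Fin 3) (Fin 3) E).charpoly = (X - C z) ^ 3 := by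
    rw [← hβchar]
    change (((h₀.1 : GL (Fin 3) E) : Matrix (Fin 3) (Fin 3) E) * ((β₀.1 : GL (Fin 3) E) : Matrix (Fin 3) (Fin 3) E) *
      (((h₀.1 : GL (Fin 3) E)⁻¹ : GL (Fin 3) E) : Matrix (Fin 3) (Fin 3) E)).charpoly = _
    rw [Matrix.coe_units_inv]
    exact Matrix.charpoly_units_conj _ _
  -- `β₀ ≠ z·1` (else `γ` would be central)
  have hβne : ((β₀.1 : GL (Fin 3) E) : Matrix (Fin 3) (Fin 3) E) ≠ z • (1 : Matrix (Fin 3) (Fin 3) E) := by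
    intro hcen
    apply hne
    have hγ₀mat : ((γ₀.1 : GL (Fin 3) E) : Matrix (Fin 3) (Fin 3) E) = z • (1 : Matrix (Fin 3) (Fin 3) E) := by
      have hγeq : γ₀ = d₁⁻¹ * β₀ * d₁ := by rw [hβ₀]; group
      rw [hγeq]
      change ((d₁.1 : GL (Fin 3) E)⁻¹ : GL (Fin 3) E) * ((β₀.1 : GL (Fin 3) E) : Matrix (Fin 3) (Fin 3) E) *
        ((d₁.1 : GL (Fin 3) E) : Matrix (Fin 3) (Fin 3) E) = _
      rw [hcen, Matrix.mul_smul, Matrix.mul_one, Matrix.smul_mul, Matrix.coe_units_inv,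
        Matrix.nonsing_inv_mul _ ((Matrix.isUnits_det_units _))]
    rw [← hγ₀]
    change (((γ₀.1 : GL (Fin 3) E) : Matrix (Fin 3) (Fin 3) E)).map (algebraMap E (AdeleRing (𝓞 E) E)) = _
    rw [hγ₀mat, Matrix.smul_one_eq_diagonal, Matrix.diagonal_map (map_zero _), Matrix.smul_one_eq_diagonal]
  -- last row of `h₀ β₀ h₀⁻¹` is `z e₃`
  have hκrow : (fun j : Fin 3 => (((h₀ * β₀ * h₀⁻¹ : (quasiSplit F E c 3).Rational).1 : GL (Fin 3) E) :
      Matrix (Fin 3) (Fin 3) E) ⊤ j) = z • Pi.single (⊤ : Fin 3) (1 : E) := by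
    have htop : (⊤ : Fin 3) = 2 := rfl
    have h22 := apply_self_eq_of_blockTriangular_of_charpoly_eq hκB hκchar 2
    have h20 := hκB (show ((0 : Fin 3) : Fin 3) < 2 by decide)
    have h21 := hκB (show ((1 : Fin 3) : Fin 3) < 2 by decide)
    funext j
    fin_cases j
    · simpa [htop, Pi.single_apply] using h20
    · simpa [htop, Pi.single_apply] using h21
    · simpa [htop, Pi.single_apply] using h22
  -- hence `(e₃ h₀) β₀ = z (e₃ h₀)`
  set ξ : Fin 3 → E := fun j => ((h₀.1 : GL (Fin 3) E) : Matrix (Fin 3) (Fin 3) E) ⊤ j with hξ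
  have heig : ξ ᵥ* ((β₀.1 : GL (Fin 3) E) : Matrix (Fin 3) (Fin 3) E) = z • ξ := by
    have h := hκrow
    rw [ratLastRow_mul, ratLastRow_mul] at h
    -- `h : (ξ ᵥ* β₀) ᵥ* h₀⁻¹ = z • e₃`; multiply by `h₀` on the right
    have h' := congrArg (fun v => v ᵥ* ((h₀.1 : GL (Fin 3) E) : Matrix (Fin 3) (Fin 3) E)) h
    rw [Matrix.vecMul_vecMul, Matrix.smul_vecMul, ← ratLastRow_eq_single_vecMul] at h'
    have hinv : ((((h₀⁻¹ : (quasiSplit F E c 3).Rational)).1 : GL (Fin 3) E) : Matrix (Fin 3) (Fin 3) E) *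
        ((h₀.1 : GL (Fin 3) E) : Matrix (Fin 3) (Fin 3) E) = 1 := by
      rw [← Units.val_mul]
      change (((h₀⁻¹ * h₀ : (quasiSplit F E c 3).Rational)).1 : GL (Fin 3) E) = (1 : Matrix (Fin 3) (Fin 3) E)
      rw [inv_mul_cancel]; rfl
    rw [hinv, Matrix.vecMul_one] at h'
    exact h'
  have hiso : ∑ i, ξ i * c (ξ (Fin.rev i)) = 0 := by
    rw [hξ, ratLastRow_eq_single_vecMul, sum_vecMul_mul_conj_vecMul_rev h₀]
    exact sum_single_top_mul_conj_rev
  have hrow := eq_smul_single_of_vecMul_eq_smul β₀ hβB hz hβchar hβne hiso heig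
  rw [mem_arithmeticBorel_iff, ← hh₀A]
  exact mem_borelAdelic_toAdelic_of_lastRow_eq_smul (a := ξ ⊤) hrow


end UnitaryGroup

end Literature.NumberTheory.Automorphic
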